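import Mathlib
import Summits.Ventures.HodgeRepro.Tier4.Line1.RationalPoints

/-!
# Tier4/Line1/PrincipalDiscrete — `k` is a discrete closed subgroup of `𝔸_k`; `k ∩ C` is finite for compact `C`

Blind re-derivation cell `pub-hodge-repro`, Tier 4 (README §9–§10), seat t4-L1-p5 (prover, LINE L1, gen 0).
The field-level form of (I1-a)/(I1-b) (`Tier4/Line1/RationalPoints.lean` proves them for `U(W)(k) ≤ U(W)(𝔸_k)`): the
principal adeles `NumberField.AdeleRing.principalSubgroup` form a discrete closed additive subgroup of `𝔸_k`, hence
meet every compact subset of `𝔸_k` in finitely many points — step (M2) of the Mostow–Tamagawa induction recorded as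
V11 of `proofs/t4/L1/I1-c-CENSUS.md` («`B(v, v) = B(gv, gv)` takes finitely many rational values on a compact set»).
Mathlib (rev 81a5d257c8e4) has neither fact.

Nothing here says anything about the status of the Hodge conjecture for CM abelian varieties, which is NOT proved
(HC_CM is NOT proved by anyone in this repository).
-/

set_option autoImplicit false

noncomputable section

namespace Summit.Ventures.HodgeRepro.Tier4.Line1

open NumberField IsDedekindDomain Topology

section Principal

variable (k : Type) [Field k] [NumberField k]

/-- **The principal adeles are discrete**: `{0}` is the trace on `k` of the neighbourhood `U` of `0` of
`exists_nhds_zero_principal`. -/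
theorem principalSubgroup_discrete : DiscreteTopology (AdeleRing.principalSubgroup (𝓞 k) k) := by
  obtain ⟨U, hU, hU0⟩ := exists_nhds_zero_principal k
  apply discreteTopology_of_isOpen_singleton_zero
  have hopen : IsOpen ((fun h : AdeleRing.principalSubgroup (𝓞 k) k => (h : AdeleRing (𝓞 k) k)) ⁻¹'
      interior U) := isOpen_interior.preimage continuous_subtype_val
  convert hopen using 1
  ext h
  simp only [Set.mem_singleton_iff, Set.mem_preimage]
  constructor
  · rintro rfl
    exact mem_interior_iff_mem_nhds.2 hU
  · intro hh
    obtain ⟨x, hx⟩ := h.2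
    have hx0 : x = 0 := hU0 x (by rw [hx]; exact interior_subset hh)
    apply Subtype.ext
    rw [← hx, hx0, map_zero]
    rfl

/-- **The principal adeles are closed** (a discrete subgroup of the Hausdorff group `𝔸_k`). -/
theorem principalSubgroup_closed :
    IsClosed ((AdeleRing.principalSubgroup (𝓞 k) k : AddSubgroup (AdeleRing (𝓞 k) k)) :
      Set (AdeleRing (𝓞 k) k)) := by
  haveI := t2Space_adeleRing k
  haveI := principalSubgroup_discrete k
  exact AddSubgroup.isClosed_of_discrete

/-- **`k` meets every compact subset of `𝔸_k` in finitely many points.** -/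
theorem finite_principal_inter_of_isCompact {C : Set (AdeleRing (𝓞 k) k)} (hC : IsCompact C) :
    {x : k | algebraMap k (AdeleRing (𝓞 k) k) x ∈ C}.Finite := by
  haveI := principalSubgroup_discrete k
  have hemb : Topology.IsClosedEmbedding
      (fun h : AdeleRing.principalSubgroup (𝓞 k) k => (h : AdeleRing (𝓞 k) k)) :=
    (principalSubgroup_closed k).isClosedEmbedding_subtypeVal
  have hfin : ((fun h : AdeleRing.principalSubgroup (𝓞 k) k => (h : AdeleRing (𝓞 k) k)) ⁻¹' C).Finite :=
    (hemb.isCompact_preimage hC).finite_of_discrete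
  -- the map `x ↦ ⟨algebraMap x, _⟩` is injective into that finite set
  let ι : k → AdeleRing.principalSubgroup (𝓞 k) k := fun x =>
    ⟨algebraMap k (AdeleRing (𝓞 k) k) x, ⟨x, rfl⟩⟩
  have hι : Function.Injective ι := fun x y hxy =>
    AdeleRing.algebraMap_injective (𝓞 k) k (congrArg Subtype.val hxy)
  have hsub : {x : k | algebraMap k (AdeleRing (𝓞 k) k) x ∈ C} ⊆ ι ⁻¹' (Subtype.val ⁻¹' C) :=
    fun x hx => hx
  exact (hfin.preimage hι.injOn).subset hsub

end Principal

end Summit.Ventures.HodgeRepro.Tier4.Line1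

end
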